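import Literature.NumberTheory.QuadraticFields.ThreeTorsion
import HarnessLib

/-!
# Crux `ArithStatLadder.IqThreeNotBPP` (stmt-QuantumAdvantage-14864), line `Sketch`: an explicit ideal class of order `3`

A CLASS-FIELD-THEORY-FREE certificate for `3 ∣ h(−4n)` (Nagell 1922-style, the explicit
construction behind "infinitely many imaginary quadratic fields with class number divisible by
`3`"): **if `u⁶ = x² + n` with `u > 1` odd, `n` squarefree and `n > u²`, then `3` divides the form
class number `h(−4n)`** (`three_dvd_classNumber_of_pow_six_eq_sq_add`).

Proof (elementary, in the tree's form–ideal dictionary for the maximal order `𝓞 K` of the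
quadratic field `K` of discriminant `−4n`, `FormIdeals.lean` ff.): `x` is even and `n ≡ 1 (mod 4)`
(otherwise `4 ∣ n`), so `−4n` is a fundamental discriminant and `h(−4n) = h_K`
(`card_reducedForms_eq_classNumber`, Cox Thm. 7.7); with an integral basis `(1, ω)`,
`ω² = m + tω`, `t = 2t'`, the element `η = ω − (t' + x) = "x + √−n"` has norm `x² + n = u⁶`, so
`𝔞 = (u², η)` is a lattice ideal; since `gcd(u², 2x) = 1` (a common prime of `u` and `x` would give
`p² ∣ n`), `𝔞² = (u⁴, η)` and `𝔞³ = (u⁶, η) = (η)` (`span_pair_mul_span_pair_of_bezout`, the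
composition of united forms with a Bezout TRIPLE `λA + μB + ν(t − 2k) = 1`, generalising the
tree's `span_pair_mul_span_pair_of_isCoprime`); and `𝔞` is not principal: `N𝔞 = u²`
(`absNorm_span_pair_eq`) while a generator `β = c₀u² + c₁η ∈ 𝔞` would have norm
`(c₀u² + t'c₁ …)² + n c₁² = u² < n`, forcing `c₁ = 0` and `c₀²u² = 1`, i.e. `u = 1`. Hence `[𝔞]`
has order `3` in `Cl(𝓞 K)` and `3 ∣ h_K` (Lagrange).

This replaces Hasse's CFT dictionary (`Hasse1930_threeTorsion_dictionary_neg`) as the YES-certificate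
of the squarefree-filter reductions `SQF ≤ IQ3` (cruxes 2422 and 14864). References: T. Nagell,
*Über die Klassenzahl imaginär-quadratischer Zahlkörper*, Abh. Math. Sem. Hamburg 1 (1922) 140–150;
D. A. Cox, *Primes of the form x² + ny²*, 2nd ed. (2013), §7.B Thm. 7.7. Theorems only; sorry-free.
-/

set_option linter.dupNamespace false -- D-0017: single-problem summit ⇒ `QuantumAdvantage.QuantumAdvantage` by design

noncomputable section

namespace Summit.QuantumAdvantage.QuantumAdvantage.Theorems.IqThreeNotBPP

open Module NumberField
open Literature.NumberTheory.QuadraticFields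
open Literature.NumberTheory.QuadraticFields.Quadratic
open scoped nonZeroDivisors

/-! ### Composition of united lattice ideals with a Bezout triple -/

section QuadraticRing

variable {R : Type*} [CommRing R] (b : Basis (Fin 2) ℤ R)
variable {t m : ℤ} (hω : b 1 * b 1 = (m : R) + (t : R) * b 1)

include hω in
/-- **Product of united lattice ideals.** For `η = ω − k` with `AB ∣ N(η)` (`ABC = k² − tk − m`)
and a Bezout TRIPLE `λA + μB + ν(t − 2k) = 1` (i.e. `gcd(A, B, t − 2k) = 1`, the forms
`(A, 2k − t, BC)` and `(B, 2k − t, AC)` are united): `(A, η) · (B, η) = (AB, η)` — Dirichlet's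
composition (Cox, Lemma 3.2 / (7.12)); the tree's `span_pair_mul_span_pair_of_isCoprime` is the
case `gcd(A, B) = 1`. [cite: Cox2013, §3.A Lemma 3.2 and §7.B (7.12)] -/
theorem span_pair_mul_span_pair_of_bezout {A B C k : ℤ} (hn : A * B * C = k ^ 2 - t * k - m)
    (hbez : ∃ x y z : ℤ, x * A + y * B + z * (t - 2 * k) = 1) :
    Ideal.span {(A : R), b 1 - k} * Ideal.span {(B : R), b 1 - k} =
      Ideal.span {((A * B : ℤ) : R), b 1 - k} := by
  set η : R := b 1 - k with hη
  have hηη : η * η = ((t - 2 * k : ℤ) : R) * η - (C : R) * ((A * B : ℤ) : R) := by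
    have h := sub_mul_sub_eq b hω k
    rw [← hn] at h
    rw [hη, h]
    push_cast
    ring
  rw [Ideal.span_pair_mul_span_pair]
  apply le_antisymm
  · rw [Ideal.span_le]
    have hgen₁ : ((A * B : ℤ) : R) ∈ Ideal.span {((A * B : ℤ) : R), η} :=
      Ideal.subset_span (by simp)
    have hgen₂ : η ∈ Ideal.span {((A * B : ℤ) : R), η} := Ideal.subset_span (by simp)
    rintro y (rfl | rfl | rfl | rfl)
    · push_cast at hgen₁ ⊢
      exact hgen₁
    · exact Ideal.mul_mem_left _ _ hgen₂
    · exact Ideal.mul_mem_right _ _ hgen₂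
    · rw [SetLike.mem_coe, hηη]
      exact Ideal.sub_mem _ (Ideal.mul_mem_left _ _ hgen₂) (Ideal.mul_mem_left _ _ hgen₁)
  · rw [Ideal.span_le]
    obtain ⟨x, y, z, hxyz⟩ := hbez
    set J : Ideal R := Ideal.span {(A : R) * B, (A : R) * η, η * B, η * η} with hJ
    have h1 : (A : R) * B ∈ J := Ideal.subset_span (by simp)
    have h2 : (A : R) * η ∈ J := Ideal.subset_span (by simp)
    have h3 : η * B ∈ J := Ideal.subset_span (by simp)
    have h4 : η * η ∈ J := Ideal.subset_span (by simp)
    have h5 : ((t - 2 * k : ℤ) : R) * η ∈ J := by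
      have : ((t - 2 * k : ℤ) : R) * η = η * η + (C : R) * ((A : R) * B) := by
        rw [hηη]; push_cast; ring
      rw [this]
      exact Ideal.add_mem _ h4 (Ideal.mul_mem_left _ _ h1)
    rintro w (rfl | rfl)
    · rw [SetLike.mem_coe]
      have : ((A * B : ℤ) : R) = (A : R) * B := by push_cast; ring
      rw [this]
      exact h1
    · rw [SetLike.mem_coe]
      have : η = (x : R) * ((A : R) * η) + (y : R) * (η * B) +
          (z : R) * (((t - 2 * k : ℤ) : R) * η) := by
        have e := congrArg (Int.cast : ℤ → R) hxyz
        push_cast at e ⊢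
        linear_combination (-η) * e
      rw [this]
      exact Ideal.add_mem _ (Ideal.add_mem _ (Ideal.mul_mem_left _ _ h2)
        (Ideal.mul_mem_left _ _ h3)) (Ideal.mul_mem_left _ _ h5)

include hω in
/-- `(N(η), η) = (η)` for `η = ω − k`, `N(η) = k² − tk − m = η(t − 2k − η)`. [folklore] -/
theorem span_pair_norm_eq_span_singleton (k : ℤ) :
    Ideal.span {((k ^ 2 - t * k - m : ℤ) : R), b 1 - k} = Ideal.span {b 1 - k} := by
  apply le_antisymm
  · rw [Ideal.span_le]
    have hη : b 1 - k ∈ Ideal.span {b 1 - (k : R)} := Ideal.mem_span_singleton_self _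
    rintro y (rfl | rfl)
    · rw [SetLike.mem_coe]
      have : ((k ^ 2 - t * k - m : ℤ) : R) =
          ((t - 2 * k : ℤ) : R) * (b 1 - k) - (b 1 - k) * (b 1 - k) := by
        rw [sub_mul_sub_eq b hω k]; ring
      rw [this]
      exact Ideal.sub_mem _ (Ideal.mul_mem_left _ _ hη) (Ideal.mul_mem_left _ _ hη)
    · exact hη
  · exact Ideal.span_mono (by simp)

end QuadraticRing

/-! ### Arithmetic of the hypothesis `u⁶ = x² + n` -/

/-- Under `u⁶ = x² + n` with `u` odd and `n` squarefree, `x` is even (otherwise both `u³ ± x` are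
even and `4 ∣ n`). [folklore] -/
theorem even_of_pow_six_eq_sq_add {u x n : ℕ} (hu : Odd u) (hn : u ^ 6 = x ^ 2 + n)
    (hsq : Squarefree n) : Even x := by
  by_contra hx
  rw [Nat.not_even_iff_odd] at hx
  have hu' : Odd ((u : ℤ) ^ 3) := (Int.odd_coe_nat u |>.2 hu).pow
  have hx' : Odd (x : ℤ) := (Int.odd_coe_nat x).2 hx
  have e1 : ((u : ℤ)) ^ 6 = (x : ℤ) ^ 2 + n := by exact_mod_cast hn
  have hprod : ((u : ℤ) ^ 3 - x) * ((u : ℤ) ^ 3 + x) = n := by linear_combination e1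
  have h4 : (4 : ℤ) ∣ (n : ℤ) := by
    rw [← hprod, show (4 : ℤ) = 2 * 2 by norm_num]
    exact mul_dvd_mul (even_iff_two_dvd.1 (hu'.sub_odd hx')) (even_iff_two_dvd.1 (hu'.add_odd hx'))
  have h4' : 2 * 2 ∣ n := by exact_mod_cast h4
  have h2 := Nat.isUnit_iff.1 (hsq 2 h4')
  omega

/-- `n ≡ 1 (mod 4)` under `u⁶ = x² + n` with `u` odd, `x` even. [folklore] -/
theorem mod_four_of_pow_six_eq_sq_add {u x n : ℕ} (hu : Odd u) (hx : Even x)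
    (hn : u ^ 6 = x ^ 2 + n) : (n : ℤ) % 4 = 1 := by
  have e1 : ((u : ℤ)) ^ 6 = (x : ℤ) ^ 2 + n := by exact_mod_cast hn
  have hu3 : Odd ((u : ℤ) ^ 3) := (Int.odd_coe_nat u |>.2 hu).pow
  have h1 : ((u : ℤ) ^ 3) ^ 2 % 4 = 1 := Int.sq_mod_four_eq_one_of_odd hu3
  obtain ⟨y, hy⟩ := hx
  have hx4 : (x : ℤ) ^ 2 = 4 * (y * y : ℤ) := by
    have : (x : ℤ) = y + y := by exact_mod_cast hy
    rw [this]; ring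
  have : (n : ℤ) = ((u : ℤ) ^ 3) ^ 2 - 4 * (y * y : ℤ) := by linear_combination -e1 - hx4
  omega

/-- A common prime factor of `u` and `x` would give `p² ∣ u⁶ − x² = n`; so `gcd(u, x) = 1` for
squarefree `n`. [folklore] -/
theorem coprime_of_pow_six_eq_sq_add {u x n : ℕ} (hn : u ^ 6 = x ^ 2 + n) (hsq : Squarefree n) :
    Nat.Coprime u x := by
  rw [Nat.coprime_iff_gcd_eq_one]
  by_contra h
  obtain ⟨p, hp, hpg⟩ := Nat.exists_prime_and_dvd h
  have hpu : p ∣ u := hpg.trans (Nat.gcd_dvd_left u x)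
  have hpx : p ∣ x := hpg.trans (Nat.gcd_dvd_right u x)
  have h6 : p * p ∣ u ^ 6 := by
    rw [show u ^ 6 = u * (u * u ^ 4) by ring]
    exact mul_dvd_mul hpu (hpu.trans (Dvd.intro _ rfl))
  have h2 : p * p ∣ x ^ 2 := by rw [sq]; exact mul_dvd_mul hpx hpx
  have hnn : p * p ∣ n := by
    have : n = u ^ 6 - x ^ 2 := by omega
    rw [this]
    exact Nat.dvd_sub h6 h2
  have := Nat.isUnit_iff.1 (hsq p hnn)
  exact hp.one_lt.ne' this

/-- **An explicit ideal class of order `3` (Nagell 1922): if `u⁶ = x² + n` with `u > 1` odd,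
`n` squarefree and `n > u²`, then `3 ∣ h(−4n)`** (`h` = the form class number
`BinaryQuadraticForm.classNumber`, `= h_K` for `K = ℚ(√−n)` by Cox Thm. 7.7). No class field theory:
the class of the lattice ideal `(u², x + √−n)` has order exactly `3` in `Cl(𝓞 K)`.
[cite: Cox2013, §7.B Thm. 7.7] -/
theorem three_dvd_classNumber_of_pow_six_eq_sq_add {u x n : ℕ} (hu : Odd u) (h1 : 1 < u)
    (hn : u ^ 6 = x ^ 2 + n) (hsq : Squarefree n) (hlt : u ^ 2 < n) :
    3 ∣ BinaryQuadraticForm.classNumber (-(4 * (n : ℤ))) := by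
  classical
  have hx := even_of_pow_six_eq_sq_add hu hn hsq
  have hn4 := mod_four_of_pow_six_eq_sq_add hu hx hn
  have hcop := coprime_of_pow_six_eq_sq_add hn hsq
  -- `−4n` is a fundamental discriminant
  have hsqn : Squarefree (-(n : ℤ)) := by
    rwa [← Int.squarefree_natAbs, Int.natAbs_neg, Int.natAbs_natCast]
  have hD : ((-(4 * (n : ℤ))) % 4 = 1 ∧ Squarefree (-(4 * (n : ℤ))) ∧ (-(4 * (n : ℤ))) ≠ 1) ∨
      (4 ∣ (-(4 * (n : ℤ))) ∧ ((-(4 * (n : ℤ))) / 4 % 4 = 2 ∨ (-(4 * (n : ℤ))) / 4 % 4 = 3) ∧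
        Squarefree ((-(4 * (n : ℤ))) / 4)) := by
    refine Or.inr ⟨⟨-(n : ℤ), by ring⟩, ?_, ?_⟩
    · have : (-(4 * (n : ℤ))) / 4 = -(n : ℤ) := by omega
      rw [this]; omega
    · have : (-(4 * (n : ℤ))) / 4 = -(n : ℤ) := by omega
      rw [this]; exact hsqn
  -- the quadratic field of discriminant `−4n`
  obtain ⟨K, _, _, h2, hdK⟩ := exists_numberField_discr_eq hD
  have hneg : NumberField.discr K < 0 := by rw [hdK]; omega
  rw [← hdK, card_reducedForms_eq_classNumber h2 hneg, NumberField.classNumber]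
  -- an integral basis `(1, ω)`, `ω² = m + tω`, `d_K = t² + 4m = −4n`
  obtain ⟨b, hb⟩ := exists_basis_zero_eq_one h2
  have hω := basis_one_mul_self_eq b hb
  have hdisc := discr_eq_sq_add_four_mul b hb
  set m : ℤ := b.repr (b 1 * b 1) 0 with hm
  set t : ℤ := b.repr (b 1 * b 1) 1 with ht
  have htm : t ^ 2 + 4 * m = -(4 * (n : ℤ)) := by rw [← hdisc, hdK]
  -- `t = 2t'`
  have hteven : Even t := by
    have h4 : Even (t ^ 2) := ⟨2 * (-(n : ℤ) - m), by linear_combination htm⟩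
    exact (Int.even_pow.1 h4).1
  obtain ⟨t', ht'⟩ := hteven
  have hm' : m = -(n : ℤ) - t' ^ 2 := by
    rw [ht'] at htm
    nlinarith
  -- the planted element `η = ω − k`, `k = t' + x`, of norm `u⁶`
  set k : ℤ := t' + x with hk
  set a : ℤ := (u : ℤ) ^ 2 with ha
  have e1 : ((u : ℤ)) ^ 6 = (x : ℤ) ^ 2 + n := by exact_mod_cast hn
  have hnormk : k ^ 2 - t * k - m = (u : ℤ) ^ 6 := by
    rw [hk, ht', hm']; linear_combination -e1
  have hn1 : a * (a * (u : ℤ) ^ 2) = k ^ 2 - t * k - m := by rw [hnormk, ha]; ring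
  have hn2 : a * a * (u : ℤ) ^ 2 = k ^ 2 - t * k - m := by rw [hnormk, ha]; ring
  have hn3 : a * a * a * 1 = k ^ 2 - t * k - m := by rw [hnormk, ha]; ring
  -- Bezout: `gcd(u², 2x) = 1`, and `t − 2k = −2x`
  have hc2 : Nat.Coprime (u ^ 2) (2 * x) :=
    (Nat.Coprime.mul_right (Nat.coprime_two_right.2 hu) hcop).pow_left 2
  obtain ⟨p, q, hpq⟩ := Nat.isCoprime_iff_coprime.2 hc2
  have hpq' : p * a + q * (2 * (x : ℤ)) = 1 := by rw [ha]; exact_mod_cast hpq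
  have htk : t - 2 * k = -(2 * (x : ℤ)) := by rw [hk, ht']; ring
  -- the ideal `𝔞 = (u², η)` and its cube
  set η : 𝓞 K := b 1 - (k : 𝓞 K) with hη
  set 𝔞 : Ideal (𝓞 K) := Ideal.span {(a : 𝓞 K), η} with h𝔞
  have h𝔞2 : 𝔞 * 𝔞 = Ideal.span {((a * a : ℤ) : 𝓞 K), η} :=
    span_pair_mul_span_pair_of_bezout b hω hn2 ⟨p, 0, -q, by rw [htk]; linear_combination hpq'⟩
  have h𝔞3 : 𝔞 * 𝔞 * 𝔞 = Ideal.span {η} := by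
    rw [h𝔞2, span_pair_mul_span_pair_of_bezout b hω hn3 ⟨0, p, -q, by rw [htk]; linear_combination hpq'⟩,
      show a * a * a = k ^ 2 - t * k - m by rw [← hn3]; ring, span_pair_norm_eq_span_singleton b hω k]
  -- `𝔞 ≠ 0`
  have ha0 : a ≠ 0 := by rw [ha]; positivity
  have h𝔞0 : 𝔞 ∈ (Ideal (𝓞 K))⁰ := by
    rw [mem_nonZeroDivisors_iff_ne_zero]
    intro h0
    have hmem : (a : 𝓞 K) ∈ 𝔞 := Ideal.subset_span (by simp)
    rw [h0] at hmem
    exact ha0 (intCast_eq_zero_of_basis b hb (Ideal.mem_bot.1 hmem))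
  -- the class `c = [𝔞]` has `c³ = 1`
  set c : ClassGroup (𝓞 K) := ClassGroup.mk0 ⟨𝔞, h𝔞0⟩ with hc
  have hc3 : c ^ 3 = 1 := by
    have : c ^ 3 = ClassGroup.mk0 ⟨𝔞 ^ 3, pow_mem h𝔞0 3⟩ := by
      rw [hc, ← map_pow, SubmonoidClass.mk_pow]
    rw [this, ClassGroup.mk0_eq_one_iff, pow_three', h𝔞3]
    exact ⟨⟨η, rfl⟩⟩
  -- `c ≠ 1`: `𝔞` is not principal (`N𝔞 = u² < n`)
  have hc1 : c ≠ 1 := by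
    intro h
    rw [hc, ClassGroup.mk0_eq_one_iff] at h
    haveI := h
    obtain ⟨β, hβ⟩ := Submodule.IsPrincipal.principal 𝔞
    -- norms
    have hN𝔞 : Ideal.absNorm 𝔞 = a.natAbs := absNorm_span_pair_eq b hb hω hn1
    have hβmem : β ∈ 𝔞 := by rw [hβ]; exact Ideal.mem_span_singleton_self β
    obtain ⟨c₀, c₁, hβc⟩ := (mem_span_pair_iff_of_basis b hb hω hn1 β).1 hβmem
    have hβ' : β = ((c₀ * a - c₁ * k : ℤ) : 𝓞 K) + (c₁ : 𝓞 K) * b 1 := by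
      rw [hβc]; push_cast; ring
    have hNβ : Ideal.absNorm 𝔞 = (Algebra.norm ℤ β).natAbs := by
      conv_lhs => rw [hβ]
      exact Ideal.absNorm_span_singleton β
    rw [hβ', norm_intCast_add_intCast_mul b hb hω, hN𝔞] at hNβ
    have hnonneg := normForm_nonneg (t := t) (m := m) (by rw [htm]; omega) (c₀ * a - c₁ * k) c₁
    have heq : (c₀ * a - c₁ * k) ^ 2 + t * (c₀ * a - c₁ * k) * c₁ - m * c₁ ^ 2 = a := by
      have h := congrArg (fun z : ℕ => (z : ℤ)) hNβ
      simp only [Int.natCast_natAbs] at h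
      rw [abs_of_nonneg hnonneg, ha, abs_of_nonneg (by positivity)] at h
      rw [ha]; exact h.symm
    -- `(c₀a − c₁k + t'c₁)² + n c₁² = a = u² < n` forces `c₁ = 0`, then `c₀² u² = 1`
    rw [ht', hm'] at heq
    have hsq_id : (c₀ * a - c₁ * k + t' * c₁) ^ 2 + (n : ℤ) * c₁ ^ 2 = a := by
      linear_combination heq
    have hlt' : a < (n : ℤ) := by rw [ha]; exact_mod_cast hlt
    have hc₁ : c₁ = 0 := by
      by_contra hne
      have h1le : 1 ≤ c₁ ^ 2 := (one_le_sq_iff_one_le_abs c₁).2 (Int.one_le_abs hne)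
      have hnc : (n : ℤ) * 1 ≤ (n : ℤ) * c₁ ^ 2 :=
        mul_le_mul_of_nonneg_left h1le (Int.natCast_nonneg n)
      linarith [sq_nonneg (c₀ * a - c₁ * k + t' * c₁)]
    rw [hc₁] at hsq_id
    have h' : (c₀ * a) ^ 2 = a := by linear_combination hsq_id
    rw [ha] at h'
    have hu0 : ((u : ℤ)) ^ 2 ≠ 0 := by positivity
    have h'' : (c₀ * (u : ℤ)) ^ 2 = 1 := by
      have hz : ((u : ℤ)) ^ 2 * ((c₀ * (u : ℤ)) ^ 2 - 1) = 0 := by linear_combination h'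
      rcases mul_eq_zero.1 hz with h0 | h0
      · exact absurd h0 hu0
      · linear_combination h0
    have hdvd : (u : ℤ) ∣ 1 := by
      rcases sq_eq_one_iff.1 h'' with h0 | h0
      · exact ⟨c₀, by linear_combination -h0⟩
      · exact ⟨-c₀, by linear_combination h0⟩
    have hu1 : (u : ℤ) = 1 := Int.eq_one_of_dvd_one (Int.natCast_nonneg u) hdvd
    omega
  -- Lagrange
  haveI : Fact (Nat.Prime 3) := ⟨Nat.prime_three⟩
  rw [← orderOf_eq_prime hc3 hc1]
  exact orderOf_dvd_card

/-- **STUB C · `stub_orderThreeCert`** of the line `Sketch` (skeleton v3) for the crux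
`ArithStatLadder.IqThreeNotBPP` — the registered signature, discharged by
`three_dvd_classNumber_of_pow_six_eq_sq_add`. [cite: Cox2013, §7.B Thm. 7.7] -/
theorem stub_orderThreeCert :
    ∀ u x n : ℕ, Odd u → 1 < u → u ^ 6 = x ^ 2 + n → Squarefree n → u ^ 2 < n →
      3 ∣ BinaryQuadraticForm.classNumber (-(4 * (n : ℤ))) :=
  fun _ _ _ hu h1 hn hsq hlt => three_dvd_classNumber_of_pow_six_eq_sq_add hu h1 hn hsq hlt

end Summit.QuantumAdvantage.QuantumAdvantage.Theorems.IqThreeNotBPP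

end
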